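import Summits.CriticalPhenomena.PercolationContinuityZ3.Theorems.PercNearOneGluingNoHeavyLowerTailSahiSharedChainWaterfill
import Mathlib.Tactic.Linarith
import Mathlib.Tactic.Ring
import Mathlib.Tactic.FieldSimp
import HarnessLib

/-!
# `NoHeavyLowerTail` (crux stmt-CriticalPhenomena-4575), P2 — THEOREM C part B2: the water-filling RATIO on a chain: range, `(⋆)`, covariance lemma

Memo SAHI-ROUTE.md §4.29(c) (seat `prim-masterthm-p2`, gen 8).  Pure real-sequence lemmas (top-down indices `k = 0..n`, `0` = top); no `sorry`.
Continues `…SahiSharedChainWaterfill`: `surplus e = Ȳ − EH·F`, the ratio `ρ k = (z k + EH F k)/Ȳ k` (`1` where `Ȳ k = 0`), and — under the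
environment hypotheses (`F, Ȳ, H̄ ≥ 0` antitone, `Ȳ ≥ F·H̄`, `H̄` with `w`-mean `EH` on the block `0..n`) — RANGE `0 ≤ ρ ≤ 1` with `ρȲ − EH·F = z`,
the monotonicity `H1: ρ_k F_{k'} ≤ ρ_{k'} F_k` (`k ≤ k'`), the ratio condition `(⋆) F_{k'} ≤ (1 − ρ_k + ρ_{k'}) F_k`, Abel summation, and the
covariance lemma `W_n Σ w G z ≥ (Σ w G)(Σ w z)` for antitone `G` and a top-heavy profile.
-/

noncomputable section

namespace Summit.CriticalPhenomena.PercolationContinuityZ3.Theorems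

namespace SahiSharedChain

open Finset

/-! ## Part B2: the water-filling RATIO `ρ`, its range, the ratio condition `(⋆)` via `ρ/F` monotone, and the Abel/covariance lemma -/

section Ratio

variable (w F Yb : ℕ → ℝ) (EH : ℝ)

/-- The surplus profile `e k = Ȳ k − EH·F k` (top-down indices). [this work] -/
def surplus : ℕ → ℝ := fun k => Yb k - EH * F k

/-- The water-filling ratio `ρ k = (z k + EH F k)/Ȳ k` (`1` where `Ȳ k = 0`). [this work] -/
def rho (k : ℕ) : ℝ := if Yb k = 0 then 1 else (z w (surplus F Yb EH) k + EH * F k) / Yb k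

variable {w F Yb EH}

/-- Block sums of an antitone function with block-`n` mean `EH` are top-heavy: `Σ_{j≤k} w j (Hb j − EH) ≥ 0` for `k ≤ n`. [folklore] -/
theorem prefix_nonneg_of_antitone {Hb : ℕ → ℝ} {n : ℕ} (hw : ∀ k, 0 < w k) (hHb : Antitone Hb)
    (hmean : ∑ j ∈ range (n + 1), w j * Hb j = EH * ∑ j ∈ range (n + 1), w j) :
    ∀ k ≤ n, 0 ≤ ∑ j ∈ range (k + 1), w j * (Hb j - EH) := by
  intro k hkn
  have hw0 : ∀ k, 0 ≤ w k := fun k => (hw k).le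
  have hWk : 0 < ∑ j ∈ range (k + 1), w j := sum_pos (fun j _ => hw j) ⟨0, by simp⟩
  have hsub : range (k + 1) ⊆ range (n + 1) := range_mono (by omega)
  have splitW : (∑ j ∈ range (n + 1), w j) = (∑ j ∈ range (k + 1), w j) + ∑ j ∈ range (n + 1) \ range (k + 1), w j := by
    rw [← sum_sdiff hsub, add_comm]
  have splitH : (∑ j ∈ range (n + 1), w j * Hb j) =
      (∑ j ∈ range (k + 1), w j * Hb j) + ∑ j ∈ range (n + 1) \ range (k + 1), w j * Hb j := by
    rw [← sum_sdiff hsub, add_comm]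
  -- on the top block Hb ≥ Hb k, on the rest Hb ≤ Hb k
  have top : Hb k * (∑ j ∈ range (k + 1), w j) ≤ ∑ j ∈ range (k + 1), w j * Hb j := by
    rw [mul_sum]
    exact sum_le_sum fun j hj => by
      have := mul_le_mul_of_nonneg_left (hHb (Nat.lt_succ_iff.mp (mem_range.mp hj))) (hw0 j); linarith
  have bot : (∑ j ∈ range (n + 1) \ range (k + 1), w j * Hb j) ≤ Hb k * ∑ j ∈ range (n + 1) \ range (k + 1), w j := by
    rw [mul_sum]
    refine sum_le_sum fun j hj => ?_
    have hj' : k ≤ j := by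
      have := (mem_sdiff.mp hj).2; rw [mem_range, not_lt] at this; omega
    have := mul_le_mul_of_nonneg_left (hHb hj') (hw0 j)
    linarith
  have e1 : (∑ j ∈ range (k + 1), w j * (Hb j - EH)) = (∑ j ∈ range (k + 1), w j * Hb j) - EH * ∑ j ∈ range (k + 1), w j := by
    rw [mul_sum, ← sum_sub_distrib]; exact sum_congr rfl fun j _ => by ring
  rw [e1]
  have hR0 : 0 ≤ ∑ j ∈ range (n + 1) \ range (k + 1), w j := sum_nonneg fun j _ => hw0 j
  have hm : (∑ j ∈ range (k + 1), w j * Hb j) + (∑ j ∈ range (n + 1) \ range (k + 1), w j * Hb j) =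
      EH * ((∑ j ∈ range (k + 1), w j) + ∑ j ∈ range (n + 1) \ range (k + 1), w j) := by rw [← splitH, hmean, splitW]
  -- T R ≥ Hb_k Wk R ≥ B Wk, T + B = EH (Wk + R)  ⇒  T (Wk + R) ≥ EH (Wk + R) Wk  ⇒  T ≥ EH Wk
  have h1 : (∑ j ∈ range (k + 1), w j * Hb j) * (∑ j ∈ range (n + 1) \ range (k + 1), w j) ≥
      (∑ j ∈ range (n + 1) \ range (k + 1), w j * Hb j) * ∑ j ∈ range (k + 1), w j := by
    nlinarith [mul_le_mul_of_nonneg_right top hR0, mul_le_mul_of_nonneg_right bot hWk.le]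
  have hpos : 0 < (∑ j ∈ range (k + 1), w j) + ∑ j ∈ range (n + 1) \ range (k + 1), w j := by linarith
  have h2 : EH * (∑ j ∈ range (k + 1), w j) * ((∑ j ∈ range (k + 1), w j) + ∑ j ∈ range (n + 1) \ range (k + 1), w j) ≤
      (∑ j ∈ range (k + 1), w j * Hb j) * ((∑ j ∈ range (k + 1), w j) + ∑ j ∈ range (n + 1) \ range (k + 1), w j) := by
    nlinarith [hm, h1]
  have := le_of_mul_le_mul_right h2 hpos
  linarith

/-- `Ȳ ≥ 0` from `Ȳ ≥ F·H̄`, `F, H̄ ≥ 0`. [this work] -/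
theorem Yb_nonneg {Hb : ℕ → ℝ} (hF0 : ∀ k, 0 ≤ F k) (hHb0 : ∀ k, 0 ≤ Hb k) (hYFH : ∀ k, F k * Hb k ≤ Yb k) (k : ℕ) :
    0 ≤ Yb k := le_trans (mul_nonneg (hF0 k) (hHb0 k)) (hYFH k)

/-- **RANGE and the defining relation.**  Under the environment hypotheses, for `k ≤ n`: `0 ≤ ρ k ≤ 1` and `ρ k · Ȳ k − EH·F k = z k`. [this work] -/
theorem rho_spec {Hb : ℕ → ℝ} {n : ℕ} (hw : ∀ k, 0 < w k) (hF0 : ∀ k, 0 ≤ F k) (hF : Antitone F)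
    (hHb0 : ∀ k, 0 ≤ Hb k) (hHb : Antitone Hb) (hYFH : ∀ k, F k * Hb k ≤ Yb k)
    (hmean : ∑ j ∈ range (n + 1), w j * Hb j = EH * ∑ j ∈ range (n + 1), w j) :
    ∀ k ≤ n, 0 ≤ rho w F Yb EH k ∧ rho w F Yb EH k ≤ 1 ∧
      rho w F Yb EH k * Yb k - EH * F k = z w (surplus F Yb EH) k ∧ 0 ≤ z w (surplus F Yb EH) k + EH * F k := by
  have hκ : Antitone (fun k => Hb k - EH) := fun a b hab => by simp only; linarith [hHb hab]
  have hκs := prefix_nonneg_of_antitone (EH := EH) hw hHb hmean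
  have he : ∀ k, F k * (Hb k - EH) ≤ surplus F Yb EH k := fun k => by
    unfold surplus; nlinarith [hYFH k]
  have main := z_ge_and_A_nonneg (e := surplus F Yb EH) hw hF0 hF hκ hκs he
  intro k hkn
  have hzlow : 0 ≤ z w (surplus F Yb EH) k + EH * F k := by
    have := (main k hkn).1
    nlinarith [mul_nonneg (hF0 k) (hHb0 k)]
  have hzle : z w (surplus F Yb EH) k ≤ Yb k - EH * F k := z_le_e k
  have hY0 := Yb_nonneg hF0 hHb0 hYFH k
  by_cases hY : Yb k = 0
  · have hρ : rho w F Yb EH k = 1 := by simp [rho, hY]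
    rw [hY] at hzle
    have hzval : z w (surplus F Yb EH) k = -(EH * F k) := by linarith
    refine ⟨by rw [hρ]; norm_num, by rw [hρ], ?_, hzlow⟩
    rw [hρ, hY, hzval]; ring
  · have hYpos : 0 < Yb k := lt_of_le_of_ne hY0 (Ne.symm hY)
    have hρ : rho w F Yb EH k = (z w (surplus F Yb EH) k + EH * F k) / Yb k := by simp [rho, hY]
    refine ⟨by rw [hρ]; exact div_nonneg hzlow hYpos.le, ?_, ?_, hzlow⟩
    · rw [hρ, div_le_one hYpos]; linarith
    · rw [hρ, div_mul_cancel₀ _ hYpos.ne']; ring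

/-- **H1 for consecutive levels**: `ρ k · F (k+1) ≤ ρ (k+1) · F k` (`k+1 ≤ n`). [this work] -/
theorem H1_succ {Hb : ℕ → ℝ} {n : ℕ} (hw : ∀ k, 0 < w k) (hF0 : ∀ k, 0 ≤ F k) (hF : Antitone F) (hYb : Antitone Yb)
    (hHb0 : ∀ k, 0 ≤ Hb k) (hHb : Antitone Hb) (hYFH : ∀ k, F k * Hb k ≤ Yb k)
    (hmean : ∑ j ∈ range (n + 1), w j * Hb j = EH * ∑ j ∈ range (n + 1), w j) {k : ℕ} (hk : k + 1 ≤ n) :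
    rho w F Yb EH k * F (k + 1) ≤ rho w F Yb EH (k + 1) * F k := by
  have RS := rho_spec hw hF0 hF hHb0 hHb hYFH hmean
  obtain ⟨hρ0, hρ1, hρz, hz0⟩ := RS k (by omega)
  obtain ⟨hρ0', hρ1', hρz', hz0'⟩ := RS (k + 1) hk
  have hκ : Antitone (fun k => Hb k - EH) := fun a b hab => by simp only; linarith [hHb hab]
  have hA0 : 0 ≤ A w (surplus F Yb EH) k :=
    (z_ge_and_A_nonneg (e := surplus F Yb EH) hw hF0 hF hκ (prefix_nonneg_of_antitone (EH := EH) hw hHb hmean)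
      (fun k => by show F k * (Hb k - EH) ≤ surplus F Yb EH k; unfold surplus; nlinarith [hYFH k]) k (by omega)).2
  have hzk1 : z w (surplus F Yb EH) (k + 1) = min (surplus F Yb EH (k + 1)) (A w (surplus F Yb EH) k) := rfl
  by_cases hcase : A w (surplus F Yb EH) k < surplus F Yb EH (k + 1)
  · -- level k+1 capped: z (k+1) = A k, Ȳ (k+1) > 0
    have hz1 : z w (surplus F Yb EH) (k + 1) = A w (surplus F Yb EH) k := by rw [hzk1, min_eq_right hcase.le]
    have hek1 : surplus F Yb EH (k + 1) = Yb (k + 1) - EH * F (k + 1) := rfl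
    have hYpos : 0 < Yb (k + 1) := by
      have h0 := hz0'
      rw [hz1] at h0
      rw [hek1] at hcase
      linarith
    -- z k ≤ A k  (k = 0: A 0 = z 0; else z k ≤ A (k-1) and A k is an average of A (k-1) and z k)
    have hzA : z w (surplus F Yb EH) k ≤ A w (surplus F Yb EH) k := by
      have hS := S_eq_A_mul_W (e := surplus F Yb EH) hw k
      cases k with
      | zero =>
        have : (SW w (surplus F Yb EH) 0).1 = w 0 * z w (surplus F Yb EH) 0 := by simp [SW, z]
        have hW : (SW w (surplus F Yb EH) 0).2 = w 0 := by simp [SW]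
        rw [this, hW] at hS
        nlinarith [hw 0]
      | succ k' =>
        have hz' : z w (surplus F Yb EH) (k' + 1) ≤ A w (surplus F Yb EH) k' := z_succ_le_A k'
        have h0 := S_eq_A_mul_W (e := surplus F Yb EH) hw k'
        rw [SW_succ_fst, SW_succ_snd, h0] at hS
        have hW := W_pos (e := surplus F Yb EH) hw k'
        -- A k' W + w z = A(k'+1) (W + w), z ≤ A k'  ⇒ z ≤ A (k'+1)
        nlinarith [mul_le_mul_of_nonneg_left hz' hW.le, hw (k' + 1)]
    -- chain: ρ_k F_{k+1} Ȳ_{k+1} ≤ ρ_k Ȳ_k F_{k+1} = (z_k + EHF_k) F_{k+1} ≤ (A_k + EH F_k) F_{k+1} ≤ A_k F_k + EH F_k F_{k+1} = ρ_{k+1} Ȳ_{k+1} F_k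
    have s1 : rho w F Yb EH k * F (k + 1) * Yb (k + 1) ≤ rho w F Yb EH k * F (k + 1) * Yb k :=
      mul_le_mul_of_nonneg_left (hYb (Nat.le_succ k)) (mul_nonneg hρ0 (hF0 _))
    have s2 : rho w F Yb EH k * Yb k = z w (surplus F Yb EH) k + EH * F k := by linarith [hρz]
    have s3 : (z w (surplus F Yb EH) k + EH * F k) * F (k + 1) ≤ (A w (surplus F Yb EH) k + EH * F k) * F (k + 1) :=
      mul_le_mul_of_nonneg_right (by linarith) (hF0 _)
    have s4 : A w (surplus F Yb EH) k * F (k + 1) ≤ A w (surplus F Yb EH) k * F k := mul_le_mul_of_nonneg_left (hF (Nat.le_succ k)) hA0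
    have s5 : rho w F Yb EH (k + 1) * Yb (k + 1) = A w (surplus F Yb EH) k + EH * F (k + 1) := by linarith [hρz', hz1]
    have h2' : rho w F Yb EH k * Yb k * F (k + 1) = (z w (surplus F Yb EH) k + EH * F k) * F (k + 1) := by rw [s2]
    have h5' : rho w F Yb EH (k + 1) * Yb (k + 1) * F k = (A w (surplus F Yb EH) k + EH * F (k + 1)) * F k := by rw [s5]
    have key : rho w F Yb EH k * F (k + 1) * Yb (k + 1) ≤ rho w F Yb EH (k + 1) * F k * Yb (k + 1) := by
      linarith [s1, h2', s3, s4, h5']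
    exact le_of_mul_le_mul_right key hYpos
  · -- uncapped: z (k+1) = e (k+1) ⇒ ρ (k+1) = 1
    have hz1 : z w (surplus F Yb EH) (k + 1) = surplus F Yb EH (k + 1) := by rw [hzk1, min_eq_left (not_lt.mp hcase)]
    have hρ1eq : rho w F Yb EH (k + 1) = 1 := by
      by_cases hY : Yb (k + 1) = 0
      · simp [rho, hY]
      · have hYpos : 0 < Yb (k + 1) := lt_of_le_of_ne (Yb_nonneg hF0 hHb0 hYFH _) (Ne.symm hY)
        have : rho w F Yb EH (k + 1) * Yb (k + 1) = Yb (k + 1) := by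
          rw [show rho w F Yb EH (k + 1) * Yb (k + 1) = z w (surplus F Yb EH) (k + 1) + EH * F (k + 1) by linarith [hρz'], hz1]
          show surplus F Yb EH (k + 1) + EH * F (k + 1) = Yb (k + 1)
          unfold surplus; ring
        field_simp at this ⊢
        nlinarith [this, hYpos]
    rw [hρ1eq, one_mul]
    calc rho w F Yb EH k * F (k + 1) ≤ 1 * F (k + 1) := mul_le_mul_of_nonneg_right hρ1 (hF0 _)
      _ = F (k + 1) := one_mul _
      _ ≤ F k := hF (Nat.le_succ k)

/-- **H1**: `ρ k · F k' ≤ ρ k' · F k` for `k ≤ k' ≤ n` (i.e. `ρ/F` is non-increasing bottom-up). [this work] -/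
theorem H1 {Hb : ℕ → ℝ} {n : ℕ} (hw : ∀ k, 0 < w k) (hF0 : ∀ k, 0 ≤ F k) (hF : Antitone F) (hYb : Antitone Yb)
    (hHb0 : ∀ k, 0 ≤ Hb k) (hHb : Antitone Hb) (hYFH : ∀ k, F k * Hb k ≤ Yb k)
    (hmean : ∑ j ∈ range (n + 1), w j * Hb j = EH * ∑ j ∈ range (n + 1), w j) {k k' : ℕ} (hkk : k ≤ k') (hk'n : k' ≤ n) :
    rho w F Yb EH k * F k' ≤ rho w F Yb EH k' * F k := by
  induction hkk with
  | refl => exact le_rfl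
  | @step m hkm ih =>
    have hkm' : k ≤ m := hkm
    have ih' := ih (by omega)
    have step := H1_succ hw hF0 hF hYb hHb0 hHb hYFH hmean (k := m) hk'n
    have RS := rho_spec hw hF0 hF hHb0 hHb hYFH hmean
    have hρm1 := (RS (m + 1) hk'n).1
    have hρk := (RS k (by omega)).1
    by_cases hFm : F m = 0
    · have : F (m + 1) = 0 := le_antisymm (by rw [← hFm]; exact hF (Nat.le_succ m)) (hF0 _)
      rw [this, mul_zero]; exact mul_nonneg hρm1 (hF0 k)
    · have hFpos : 0 < F m := lt_of_le_of_ne (hF0 m) (Ne.symm hFm)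
      -- ρ_k F_{m+1} F_m ≤ ρ_m F_k F_{m+1} ≤ ρ_{m+1} F_m F_k
      have h1 : rho w F Yb EH k * F (m + 1) * F m ≤ rho w F Yb EH m * F k * F (m + 1) := by
        nlinarith [mul_le_mul_of_nonneg_right ih' (hF0 (m + 1))]
      have h2 : rho w F Yb EH m * F (m + 1) * F k ≤ rho w F Yb EH (m + 1) * F m * F k :=
        mul_le_mul_of_nonneg_right step (hF0 k)
      have : rho w F Yb EH k * F (m + 1) * F m ≤ rho w F Yb EH (m + 1) * F k * F m := by nlinarith [h1, h2]
      exact le_of_mul_le_mul_right this hFpos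

/-- **`(⋆)` for the water-filling ratio**: `F k' ≤ (1 − ρ k + ρ k') F k` for `k ≤ k' ≤ n` (top-down indices: `k` is the higher level). [this work] -/
theorem star_topdown {Hb : ℕ → ℝ} {n : ℕ} (hw : ∀ k, 0 < w k) (hF0 : ∀ k, 0 ≤ F k) (hF : Antitone F) (hYb : Antitone Yb)
    (hHb0 : ∀ k, 0 ≤ Hb k) (hHb : Antitone Hb) (hYFH : ∀ k, F k * Hb k ≤ Yb k)
    (hmean : ∑ j ∈ range (n + 1), w j * Hb j = EH * ∑ j ∈ range (n + 1), w j) {k k' : ℕ} (hkk : k ≤ k') (hk'n : k' ≤ n) :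
    F k' ≤ (1 - rho w F Yb EH k + rho w F Yb EH k') * F k := by
  have h := H1 hw hF0 hF hYb hHb0 hHb hYFH hmean hkk hk'n
  have hρ1 := (rho_spec hw hF0 hF hHb0 hHb hYFH hmean k (by omega)).2.1
  nlinarith [mul_le_mul_of_nonneg_left (hF hkk) (sub_nonneg.mpr hρ1), hF0 k']

/-! ### Abel summation and the covariance lemma -/

/-- Abel summation (top-down): `Σ_{k≤n} w_k G_k X_k = G_n Σ_{k≤n} w_k X_k + Σ_{u<n} (G_u − G_{u+1}) Σ_{k≤u} w_k X_k`. [folklore] -/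
theorem abel (G X : ℕ → ℝ) (n : ℕ) :
    (∑ k ∈ range (n + 1), w k * G k * X k) =
      G n * (∑ k ∈ range (n + 1), w k * X k) + ∑ u ∈ range n, (G u - G (u + 1)) * ∑ k ∈ range (u + 1), w k * X k := by
  induction n with
  | zero => simp; ring
  | succ n ih =>
    rw [sum_range_succ, ih, sum_range_succ (fun u => (G u - G (u + 1)) * ∑ k ∈ range (u + 1), w k * X k) n,
      sum_range_succ (fun k => w k * X k) (n + 1)]
    ring

/-- **Covariance lemma**: for `G` antitone (top-down) and a TOP-HEAVY profile (`W_n Σ_{k≤u} w z ≥ W_u Σ_{k≤n} w z` for `u ≤ n`):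
`W_n · Σ_{k≤n} w G z ≥ (Σ_{k≤n} w G)(Σ_{k≤n} w z)`. [this work] -/
theorem cov_nonneg_of_topheavy {G X : ℕ → ℝ} {n : ℕ} (hG : Antitone G)
    (htop : ∀ u ≤ n, (∑ k ∈ range (n + 1), w k) * (∑ k ∈ range (u + 1), w k * X k) ≥
      (∑ k ∈ range (u + 1), w k) * ∑ k ∈ range (n + 1), w k * X k) :
    (∑ k ∈ range (n + 1), w k) * (∑ k ∈ range (n + 1), w k * G k * X k) ≥
      (∑ k ∈ range (n + 1), w k * G k) * ∑ k ∈ range (n + 1), w k * X k := by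
  have a1 := abel (w := w) G X n
  have a2 := abel (w := w) G (fun _ => (1 : ℝ)) n
  simp only [mul_one] at a2
  rw [a1, a2]
  set Wn := ∑ k ∈ range (n + 1), w k
  set Pn := ∑ k ∈ range (n + 1), w k * X k
  have key : ∀ u ∈ range n, (G u - G (u + 1)) * (Wn * ∑ k ∈ range (u + 1), w k * X k) ≥
      (G u - G (u + 1)) * ((∑ k ∈ range (u + 1), w k) * Pn) := fun u hu =>
    mul_le_mul_of_nonneg_left (htop u (mem_range.mp hu).le) (sub_nonneg.mpr (hG (Nat.le_succ u)))
  have : Wn * (∑ u ∈ range n, (G u - G (u + 1)) * ∑ k ∈ range (u + 1), w k * X k) ≥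
      Pn * ∑ u ∈ range n, (G u - G (u + 1)) * ∑ k ∈ range (u + 1), w k := by
    rw [mul_sum, mul_sum]
    refine sum_le_sum fun u hu => ?_
    have := key u hu
    nlinarith [this]
  nlinarith [this]

end Ratio

end SahiSharedChain

end Summit.CriticalPhenomena.PercolationContinuityZ3.Theorems
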